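import Mathlib
import HarnessLib
import Literature.NumberTheory.LFunctions.ZetaScrew
import Summits.RiemannHypothesis.RiemannHypothesis.Theorems.IntegerScrewKNodeForm

/-!
# Route `IntegerScrew` — the pivot below the Gram form of an ARBITRARY finite set of increments,
# and the abstract «diagonal + rows» floor lemma (PIVOT-LAW §15.14, kernel road (1)–(2) and (5);
# RH-FREE given `S_{M−1} ≻ 0`)

`d_M` is the squared distance of the newest node of Kreĭn's screw line from the span of the earlier
nodes, so `d_M ≤ ‖I_M + Σ_i θ_i I_{a_i}‖²` for every finite family of increments
`I_a = x_{log a} − x_{log(a−1)}`, `3 ≤ a < M`.  `IntegerScrewKNodeForm.screwPivot_le_incrementForm` is the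
case of the `K + 1` increments next to the corner (proved by Abel summation, which needs contiguity);
`IntegerScrewHingeFloor.screwPivot_le_farTwoIncrement` the case of one far increment.  Here:

* `sum_Icc_mul_incrementNode`, `sum_Icc_mul_incrementVector` — the node functional of a linear
  combination of increment vectors `e_a − e_{a−1}`: `Σ_m f(m)·x_m = Σ_i θ_i (f(a_i) − f(a_i − 1))`;
* **`screwPivot_le_incrementGram`** — for ANY finite index set `s`, labels `a : s → [3, M]` with one
  distinguished index `i₀` of label `M` and coefficient `1`, all other labels `< M`, and `S_{M−1} ≻ 0`:
  `d_M ≤ Σ_{i,j ∈ s} θ_i θ_j·B(a_i, a_j)`,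
  `B(a,b) = Ψ(log a − log(b−1)) + Ψ(log(a−1) − log b) − Ψ(log a − log b) − Ψ(log(a−1) − log(b−1))`
  (`= ⟨I_a, I_b⟩`; no contiguity, no injectivity of the labels needed — the mixed second difference of
  the kernel `G(t,u) = Ψ(t) + Ψ(u) − Ψ(t−u)` kills the one-point terms by itself);
* **`eventually_gramFloor`** — the analytic half, abstractly: if along `M → ∞` the scaled Gram entries
  satisfy `g_M(i₀,i) → C_i` (rows), `g_M(i,i)/L_M → w_i > 0` (diagonal), `g_M(i,j)` eventually bounded
  (`i ≠ j`, both `≠ i₀`) and `L_M → ∞`, then with `θ_i = −(C_i/w_i)/L_M` (`θ_{i₀} = 1`), for every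
  `ε > 0` eventually `Σ_{i ≠ i₀} C_i²/w_i − ε ≤ (g_M(i₀,i₀) − Σ_{i,j} θ_i θ_j g_M(i,j))·L_M` — the gains
  of directions that are orthogonal to leading order ADD.

`IntegerScrewArithmeticFloor` instantiates both with the `K` neighbours and the hinge carriers
`⌈M/q⌉` of finitely many prime powers `q` (PIVOT-LAW §15.14: `liminf G·log M ≥ S_K + Σ_q Λ(q)²/q²`).
Pure algebra / elementary limits; nothing here bears on the truth of RH. [Suzuki2023, (1.4)]
-/

noncomputable section

-- D-0017: `Summit.<S>.<S>.…` is the designed namespace of a single-problem summit.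
set_option linter.dupNamespace false

namespace Summit.RiemannHypothesis.RiemannHypothesis.Theorems.IntegerScrew

open Literature.NumberTheory.LFunctions Finset Filter
open scoped Topology

/-! ### The node functional of an increment vector -/

/-- For `3 ≤ a ≤ M`: `Σ_{m ∈ [2,M]} f(m)·(e_a − e_{a−1})_m = f(a) − f(a−1)`. [folklore] -/
theorem sum_Icc_mul_incrementNode {M a : ℕ} (ha : 3 ≤ a) (haM : a ≤ M) (f : ℕ → ℝ) :
    ∑ m ∈ Icc 2 M, f m * ((if m = a then (1 : ℝ) else 0) - (if m = a - 1 then 1 else 0))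
      = f a - f (a - 1) := by
  have hmem : a ∈ Icc 2 M := Finset.mem_Icc.2 ⟨by omega, haM⟩
  have hmem' : a - 1 ∈ Icc 2 M := Finset.mem_Icc.2 ⟨by omega, by omega⟩
  simp only [mul_sub, mul_ite, mul_one, mul_zero, Finset.sum_sub_distrib, Finset.sum_ite_eq',
    hmem, hmem', if_true]

/-- The node functional of a linear combination of increment vectors: for labels `a_i ∈ [3, M]`,
`Σ_{m ∈ [2,M]} f(m)·(Σ_i θ_i (e_{a_i} − e_{a_i−1}))_m = Σ_i θ_i (f(a_i) − f(a_i − 1))`. [folklore] -/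
theorem sum_Icc_mul_incrementVector {ι : Type*} (s : Finset ι) (lab : ι → ℕ) (θ : ι → ℝ) {M : ℕ}
    (hlab : ∀ i ∈ s, 3 ≤ lab i ∧ lab i ≤ M) (f : ℕ → ℝ) :
    ∑ m ∈ Icc 2 M, f m * (∑ i ∈ s, θ i *
        ((if m = lab i then (1 : ℝ) else 0) - (if m = lab i - 1 then 1 else 0)))
      = ∑ i ∈ s, θ i * (f (lab i) - f (lab i - 1)) := by
  simp_rw [Finset.mul_sum]
  rw [Finset.sum_comm]
  refine Finset.sum_congr rfl fun i hi => ?_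
  have h := sum_Icc_mul_incrementNode (hlab i hi).1 (hlab i hi).2 f
  rw [← h, Finset.mul_sum]
  exact Finset.sum_congr rfl fun m _ => by ring

/-! ### The pivot below the Gram form of any finite set of increments -/

/-- **GENERAL INCREMENT TRIAL INEQUALITY.**  Let `s` be a finite index set with labels `lab : ι → ℕ`
and coefficients `θ : ι → ℝ`, `i₀ ∈ s` a distinguished index with `lab i₀ = M`, `θ i₀ = 1`, every other
label `< M`, all labels `≥ 3`, and `S_{M−1} = screwMatrix (M−2) ≻ 0`.  Then
`d_M ≤ Σ_{i,j ∈ s} θ_i θ_j·[Ψ(log a_i − log(a_j−1)) + Ψ(log(a_i−1) − log a_j) − Ψ(log a_i − log a_j)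
 − Ψ(log(a_i−1) − log(a_j−1))]` — the squared length of `Σ_i θ_i I_{a_i}` on the screw line
(`I_a = x_{log a} − x_{log(a−1)}`). [folklore] -/
theorem screwPivot_le_incrementGram {ι : Type*} (s : Finset ι) (lab : ι → ℕ) (θ : ι → ℝ)
    {M : ℕ} {i₀ : ι} (hi₀ : i₀ ∈ s) (hlab₀ : lab i₀ = M) (hθ₀ : θ i₀ = 1)
    (hlt : ∀ i ∈ s, i ≠ i₀ → lab i < M) (h3 : ∀ i ∈ s, 3 ≤ lab i)
    (hPD : (screwMatrix (M - 2)).PosDef) :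
    screwPivot M ≤ ∑ i ∈ s, ∑ j ∈ s, θ i * θ j *
      (zetaScrew (Real.log (lab i) - Real.log ((lab j : ℝ) - 1))
        + zetaScrew (Real.log ((lab i : ℝ) - 1) - Real.log (lab j))
        - zetaScrew (Real.log (lab i) - Real.log (lab j))
        - zetaScrew (Real.log ((lab i : ℝ) - 1) - Real.log ((lab j : ℝ) - 1))) := by
  have hM3 : 3 ≤ M := hlab₀ ▸ h3 i₀ hi₀
  obtain ⟨n, rfl⟩ : ∃ n, M = n + 2 := ⟨M - 2, by omega⟩
  have hn2 : n + 2 - 2 = n := by omega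
  rw [hn2] at hPD
  have hle : ∀ i ∈ s, 3 ≤ lab i ∧ lab i ≤ n + 2 := by
    intro i hi
    refine ⟨h3 i hi, ?_⟩
    by_cases h : i = i₀
    · rw [h, hlab₀]
    · exact (hlt i hi h).le
  -- the node vector of `Σ_i θ_i I_{a_i}`
  set x : ℕ → ℝ := fun m => ∑ i ∈ s, θ i *
    ((if m = lab i then (1 : ℝ) else 0) - (if m = lab i - 1 then 1 else 0)) with hxdef
  have hxM : x (n + 2) = 1 := by
    simp only [hxdef]
    rw [Finset.sum_eq_single_of_mem i₀ hi₀ (fun i hi hne => by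
      have := hlt i hi hne
      rw [if_neg (by omega), if_neg (by omega), sub_zero, mul_zero])]
    rw [hlab₀, hθ₀, if_pos rfl, if_neg (by omega)]
    ring
  have h1 := screwPivot_add_two_le_natForm n hPD x hxM
  -- expand the double sum by bilinearity
  set K : ℕ → ℕ → ℝ := fun m m' => zetaScrewKernel (Real.log m) (Real.log m') with hKdef
  have hinner : ∀ m ∈ Icc 2 (n + 2), ∑ m' ∈ Icc 2 (n + 2), K m m' * (x m * x m')
      = x m * ∑ j ∈ s, θ j * (K m (lab j) - K m (lab j - 1)) := by
    intro m _
    rw [← sum_Icc_mul_incrementVector s lab θ hle (K m), Finset.mul_sum]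
    exact Finset.sum_congr rfl fun m' _ => by simp only [hxdef]; ring
  have hform : ∑ m ∈ Icc 2 (n + 2), ∑ m' ∈ Icc 2 (n + 2), K m m' * (x m * x m')
      = ∑ i ∈ s, θ i * ((∑ j ∈ s, θ j * (K (lab i) (lab j) - K (lab i) (lab j - 1)))
          - ∑ j ∈ s, θ j * (K (lab i - 1) (lab j) - K (lab i - 1) (lab j - 1))) := by
    rw [Finset.sum_congr rfl hinner]
    rw [← sum_Icc_mul_incrementVector s lab θ hle
      (fun m => ∑ j ∈ s, θ j * (K m (lab j) - K m (lab j - 1)))]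
    exact Finset.sum_congr rfl fun m _ => by simp only [hxdef]; ring
  rw [hform] at h1
  refine h1.trans (le_of_eq ?_)
  refine Finset.sum_congr rfl fun i hi => ?_
  rw [← Finset.sum_sub_distrib, Finset.mul_sum]
  refine Finset.sum_congr rfl fun j hj => ?_
  have hci : ((lab i - 1 : ℕ) : ℝ) = (lab i : ℝ) - 1 := by
    rw [Nat.cast_sub (by linarith [(hle i hi).1]), Nat.cast_one]
  have hcj : ((lab j - 1 : ℕ) : ℝ) = (lab j : ℝ) - 1 := by
    rw [Nat.cast_sub (by linarith [(hle j hj).1]), Nat.cast_one]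
  simp only [hKdef, zetaScrewKernel, hci, hcj]
  ring

/-! ### The abstract floor lemma: orthogonal-to-leading-order directions add their gains -/

/-- **GRAM FLOOR LEMMA.**  Let `s` be a finite index set, `i₀ ∈ s`, `g : ℕ → ι → ι → ℝ` symmetric on
`s`, `L_M → +∞`.  Suppose that for every `i ∈ s`, `i ≠ i₀`: `g_M(i₀,i) → C_i` and `g_M(i,i)/L_M → w_i`
with `w_i > 0`, and that for `i ≠ j` in `s ∖ {i₀}` the entries `g_M(i,j)` are eventually bounded.  Then
with the coefficients `θ_{i₀} = 1`, `θ_i = −(C_i/w_i)/L_M`, for every `ε > 0`, eventually in `M`: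
`Σ_{i ∈ s ∖ {i₀}} C_i²/w_i − ε ≤ (g_M(i₀,i₀) − Σ_{i,j ∈ s} θ_i θ_j g_M(i,j))·L_M`.
(Completing squares direction by direction: each direction gains `C_i²/(w_i L_M)`, and the cross terms
are `O(1/L_M²)`.) [folklore] -/
theorem eventually_gramFloor {ι : Type*} [DecidableEq ι] (s : Finset ι) {i₀ : ι} (hi₀ : i₀ ∈ s)
    (g : ℕ → ι → ι → ℝ) (L : ℕ → ℝ) (C w : ι → ℝ)
    (hL : Tendsto L atTop atTop)
    (hsymm : ∀ M, ∀ i ∈ s, ∀ j ∈ s, g M i j = g M j i)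
    (hrow : ∀ i ∈ s, i ≠ i₀ → Tendsto (fun M => g M i₀ i) atTop (𝓝 (C i)))
    (hdiag : ∀ i ∈ s, i ≠ i₀ → Tendsto (fun M => g M i i / L M) atTop (𝓝 (w i)))
    (hw : ∀ i ∈ s, i ≠ i₀ → 0 < w i)
    (hoff : ∀ i ∈ s, ∀ j ∈ s, i ≠ i₀ → j ≠ i₀ → i ≠ j → ∃ B : ℝ, ∀ᶠ M in atTop, |g M i j| ≤ B)
    {ε : ℝ} (hε : 0 < ε) :
    ∀ᶠ M in atTop, (∑ i ∈ s.erase i₀, C i ^ 2 / w i) - ε ≤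
      (g M i₀ i₀ - ∑ i ∈ s, ∑ j ∈ s,
        (if i = i₀ then (1 : ℝ) else -(C i / w i) / L M) *
          (if j = i₀ then (1 : ℝ) else -(C j / w j) / L M) * g M i j) * L M := by
  set s' := s.erase i₀ with hs'
  set γ : ι → ℝ := fun i => C i / w i with hγ
  have hs : s = insert i₀ s' := by rw [hs', Finset.insert_erase hi₀]
  have hi₀' : i₀ ∉ s' := Finset.notMem_erase i₀ s
  have hmem' : ∀ i ∈ s', i ∈ s ∧ i ≠ i₀ := fun i hi =>
    ⟨Finset.mem_of_mem_erase hi, Finset.ne_of_mem_erase hi⟩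
  -- eventually L_M > 0
  have hLpos : ∀ᶠ M in atTop, 0 < L M := hL.eventually (eventually_gt_atTop 0)
  -- the identity: (g₀₀ − Q)·L = 2Σ γ_i g_{0i} − Σ γ_i² (g_ii/L) − Σ_{i≠j} γ_i γ_j g_ij / L
  have hident : ∀ M, 0 < L M →
      (g M i₀ i₀ - ∑ i ∈ s, ∑ j ∈ s,
        (if i = i₀ then (1 : ℝ) else -(C i / w i) / L M) *
          (if j = i₀ then (1 : ℝ) else -(C j / w j) / L M) * g M i j) * L M
      = 2 * ∑ i ∈ s', γ i * g M i₀ i - ∑ i ∈ s', γ i ^ 2 * (g M i i / L M)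
        - ∑ i ∈ s', ∑ j ∈ s'.erase i, γ i * γ j * g M i j / L M := by
    intro M hLM
    have hL0 : L M ≠ 0 := hLM.ne'
    set θf : ι → ℝ := fun i => if i = i₀ then (1 : ℝ) else -(C i / w i) / L M with hθf
    have hθ0 : θf i₀ = 1 := by simp [hθf]
    have hθ' : ∀ i ∈ s', θf i = -(γ i) / L M := fun i hi => by
      simp only [hθf, if_neg (hmem' i hi).2, hγ]
    show (g M i₀ i₀ - ∑ i ∈ s, ∑ j ∈ s, θf i * θf j * g M i j) * L M = _
    -- expand the double sum over `insert i₀ s'`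
    have hexp : ∑ i ∈ s, ∑ j ∈ s, θf i * θf j * g M i j
        = g M i₀ i₀ + 2 * ∑ i ∈ s', -(γ i) / L M * g M i₀ i
          + ∑ i ∈ s', (γ i ^ 2 / L M ^ 2 * g M i i
            + ∑ j ∈ s'.erase i, γ i * γ j / L M ^ 2 * g M i j) := by
      rw [hs, Finset.sum_insert hi₀', Finset.sum_insert hi₀',
        Finset.sum_congr rfl fun i _ => Finset.sum_insert hi₀', Finset.sum_add_distrib, hθ0]
      have hr : ∑ j ∈ s', 1 * θf j * g M i₀ j = ∑ i ∈ s', -(γ i) / L M * g M i₀ i :=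
        Finset.sum_congr rfl fun j hj => by rw [hθ' j hj, one_mul]
      have hc : ∑ i ∈ s', θf i * 1 * g M i i₀ = ∑ i ∈ s', -(γ i) / L M * g M i₀ i :=
        Finset.sum_congr rfl fun i hi => by
          rw [hθ' i hi, mul_one, hsymm M i (hmem' i hi).1 i₀ hi₀]
      have hd : ∑ i ∈ s', ∑ j ∈ s', θf i * θf j * g M i j
          = ∑ i ∈ s', (γ i ^ 2 / L M ^ 2 * g M i i
            + ∑ j ∈ s'.erase i, γ i * γ j / L M ^ 2 * g M i j) := by
        refine Finset.sum_congr rfl fun i hi => ?_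
        rw [← Finset.add_sum_erase s' _ hi, hθ' i hi]
        congr 1
        · field_simp
        · refine Finset.sum_congr rfl fun j hj => ?_
          rw [hθ' j (Finset.mem_of_mem_erase hj)]
          field_simp
      rw [hr, hc, hd]
      ring
    rw [hexp]
    have e1 : (2 * ∑ i ∈ s', -(γ i) / L M * g M i₀ i) * L M = -(2 * ∑ i ∈ s', γ i * g M i₀ i) := by
      rw [mul_comm, ← mul_assoc, Finset.mul_sum, Finset.mul_sum, ← Finset.sum_neg_distrib]
      refine Finset.sum_congr rfl fun i _ => ?_
      field_simp
    have e2 : (∑ i ∈ s', (γ i ^ 2 / L M ^ 2 * g M i i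
        + ∑ j ∈ s'.erase i, γ i * γ j / L M ^ 2 * g M i j)) * L M
        = ∑ i ∈ s', γ i ^ 2 * (g M i i / L M)
          + ∑ i ∈ s', ∑ j ∈ s'.erase i, γ i * γ j * g M i j / L M := by
      rw [Finset.sum_mul, ← Finset.sum_add_distrib]
      refine Finset.sum_congr rfl fun i _ => ?_
      rw [add_mul, Finset.sum_mul]
      congr 1
      · field_simp
      · refine Finset.sum_congr rfl fun j _ => ?_
        field_simp
    linear_combination -e1 - e2
  -- the limit of the right-hand side
  have hlim_row : Tendsto (fun M => 2 * ∑ i ∈ s', γ i * g M i₀ i) atTop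
      (𝓝 (2 * ∑ i ∈ s', γ i * C i)) :=
    (tendsto_finsetSum s' fun i hi =>
      (hrow i (hmem' i hi).1 (hmem' i hi).2).const_mul (γ i)).const_mul 2
  have hlim_diag : Tendsto (fun M => ∑ i ∈ s', γ i ^ 2 * (g M i i / L M)) atTop
      (𝓝 (∑ i ∈ s', γ i ^ 2 * w i)) :=
    tendsto_finsetSum s' fun i hi => (hdiag i (hmem' i hi).1 (hmem' i hi).2).const_mul (γ i ^ 2)
  have hLinv : Tendsto (fun M => (L M)⁻¹) atTop (𝓝 0) := hL.inv_tendsto_atTop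
  have hlim_off : Tendsto (fun M => ∑ i ∈ s', ∑ j ∈ s'.erase i, γ i * γ j * g M i j / L M) atTop
      (𝓝 0) := by
    rw [show (0 : ℝ) = ∑ i ∈ s', ∑ j ∈ s'.erase i, (0 : ℝ) by simp]
    refine tendsto_finsetSum s' fun i hi => tendsto_finsetSum _ fun j hj => ?_
    have hj' := hmem' j (Finset.mem_of_mem_erase hj)
    obtain ⟨B, hB⟩ := hoff i (hmem' i hi).1 j hj'.1 (hmem' i hi).2 hj'.2
      (Finset.ne_of_mem_erase hj).symm
    have hbound : ∀ᶠ M in atTop, ‖γ i * γ j * g M i j / L M‖ ≤ |γ i * γ j| * B * |(L M)⁻¹| := by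
      filter_upwards [hB] with M hM
      rw [Real.norm_eq_abs, div_eq_mul_inv, abs_mul, abs_mul (γ i * γ j)]
      gcongr
    refine squeeze_zero_norm' hbound ?_
    have : Tendsto (fun M => |γ i * γ j| * B * |(L M)⁻¹|) atTop (𝓝 (|γ i * γ j| * B * |0|)) :=
      ((continuous_abs.tendsto 0).comp hLinv).const_mul _
    simpa using this
  have hlim : Tendsto (fun M => 2 * ∑ i ∈ s', γ i * g M i₀ i - ∑ i ∈ s', γ i ^ 2 * (g M i i / L M)
      - ∑ i ∈ s', ∑ j ∈ s'.erase i, γ i * γ j * g M i j / L M) atTop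
      (𝓝 (2 * ∑ i ∈ s', γ i * C i - ∑ i ∈ s', γ i ^ 2 * w i - 0)) :=
    (hlim_row.sub hlim_diag).sub hlim_off
  -- the value of the limit is the floor Σ C_i²/w_i
  have hval : 2 * ∑ i ∈ s', γ i * C i - ∑ i ∈ s', γ i ^ 2 * w i - 0
      = ∑ i ∈ s', C i ^ 2 / w i := by
    rw [sub_zero, Finset.mul_sum, ← Finset.sum_sub_distrib]
    refine Finset.sum_congr rfl fun i hi => ?_
    have hwi : w i ≠ 0 := (hw i (hmem' i hi).1 (hmem' i hi).2).ne'
    simp only [hγ]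
    field_simp
    ring
  rw [hval] at hlim
  have hev := hlim.eventually (Ioi_mem_nhds (show (∑ i ∈ s', C i ^ 2 / w i) - ε
    < ∑ i ∈ s', C i ^ 2 / w i by linarith))
  filter_upwards [hev, hLpos] with M hM hLM
  rw [hident M hLM]
  exact le_of_lt hM

end Summit.RiemannHypothesis.RiemannHypothesis.Theorems.IntegerScrew

end
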